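import Summits.PneNP.PneNP.Theorems.KarlinRubinMonotoneSufficesGreedyCircuitSize
import Summits.PneNP.PneNP.Theorems.ConvexRankGatesCliqueExtLowerBoundStubIntegerThresholdCircuit

/-!
# Crux `MonotoneSuffices` (stmt-PneNP-18026), the GREEDY general detector — part 9c: the detector is a circuit

The verdict is a small circuit on the final wires (`cktSize_verdictW`: admission bits of all vertices, count bits,
the monotone counting threshold `stub_integerThresholdCircuit`, and "every level selected"); composing
`initW`, `t` layers and the verdict gives the trial (`cktSize_trialOut`, by `verdictW_iterate_eq_trialOut`), and an
OR over the `R` trials gives the detector as a genuine fan-in-2 circuit (`exists_detOut_circuit`) of size at most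
`R · S + R + 1`, `S = 300 (n+t+M+3)^6` (`trialSize_le`).
-/

set_option linter.dupNamespace false -- `Summit.PneNP.PneNP.…`: summit = sub-problem name (D-0017 single-conjunct layout)

namespace Summit.PneNP.PneNP.Theorems.MonotoneSuffices.Greedy

open Finset
open Literature.Computability.Complexity
open Literature.Probability.RandomGraphs.PlantedClique
open Summit.PneNP.PneNP.Theorems.CliqueExtLowerBound.WidthThreshold.ThresholdCircuit (stub_integerThresholdCircuit)

variable {n t M : ℕ}

/-! ### The verdict -/

/-- **The verdict is small.** [folklore] -/
theorem cktSize_verdictW (c : Fin t → Fin M → Fin n) (θ : ℕ) :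
    CktSize B2 (fun (w : (⊤ : SimpleGraph (Fin n)).edgeSet ⊕ (Fin t × Fin M) → Bool) (_ : Unit) => verdictW c θ w)
      ((Fintype.card (Fin n × Fin t × Fin M) * 1 + Fintype.card (Fin n × Fin t) * (M + 1) +
          Fintype.card (Fin n) * (t + 1) + 60 * (n + 3) ^ 4) +
        (Fintype.card (Fin t) * (M + 1) + (t + 1)) + 1) := by
  classical
  -- admission bits of all vertices, count bits, threshold
  have hOk := cktSize_okLevelW (κ := Fin n) c id
  have hCnt : CktSize B2 (fun (y : Fin n × Fin t → Bool) (u : Fin n) =>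
      if u ∈ candSet c then false else ((List.finRange t).map fun j => (u, j)).all fun q => y q)
      (Fintype.card (Fin n) * (t + 1)) :=
    CktSize.pi_const fun u => by
      by_cases hu : u ∈ candSet c
      · exact ((cktSize_const _ false).of_le (by omega)).congr fun y _ => by rw [if_pos hu]
      · have h := cktSize_all_B2 ((List.finRange t).map fun j => (u, j))
        rw [List.length_map, List.length_finRange] at h
        exact h.congr fun y _ => by rw [if_neg hu]
  obtain ⟨Ψ, hΨB, hΨs, hΨe⟩ := stub_integerThresholdCircuit n 1 (fun _ => 1) θ (fun _ => by norm_num)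
  have hmono01 : monotoneBasis01 ⊆ B2 := by
    intro g hg
    simp only [monotoneBasis01, Set.mem_insert_iff] at hg
    rcases hg with rfl | rfl | hg
    · exact const_mem_B2 true
    · exact const_mem_B2 false
    · exact (monotoneBasis_subset_deMorgan.trans deMorganBasis_subset_B2) hg
  have hThr : CktSize B2 (fun (v : Fin n → Bool) (_ : Unit) => decide (θ ≤ ∑ j : Fin n, (1 * if v j then 1 else 0)))
      (60 * (n + 3) ^ 4) := by
    have e3 : 60 * (n + 1 + 2) ^ 4 = 60 * (n + 3) ^ 4 := by ring
    exact (((Ψ.cktSize_eval hΨB).basis_mono hmono01).of_le (hΨs.trans e3.le)).congr fun v _ => by rw [hΨe]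
  have hCount := (hOk.comp hCnt).comp hThr
  -- every level selected
  have hSel : CktSize B2 (fun (w : (⊤ : SimpleGraph (Fin n)).edgeSet ⊕ (Fin t × Fin M) → Bool) (i : Fin t) =>
      ((List.finRange M).map fun m => (Sum.inr (i, m) : (⊤ : SimpleGraph (Fin n)).edgeSet ⊕ (Fin t × Fin M))).any fun q => w q)
      (Fintype.card (Fin t) * (M + 1)) :=
    CktSize.pi_const fun i => by
      have h := cktSize_any_B2 ((List.finRange M).map fun m => (Sum.inr (i, m) : (⊤ : SimpleGraph (Fin n)).edgeSet ⊕ (Fin t × Fin M)))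
      rwa [List.length_map, List.length_finRange] at h
  have hAllSel : CktSize B2 (fun (s : Fin t → Bool) (_ : Unit) => (List.finRange t).all fun i => s i) (t + 1) := by
    have h := cktSize_all_B2 (ι := Fin t) (List.finRange t)
    rwa [List.length_finRange] at h
  have hSucc := hSel.comp hAllSel
  -- combine with one AND gate
  have hBoth := (hCount.pair hSucc).comp (cktSize_and (ι := Unit ⊕ Unit) (Sum.inr ()) (Sum.inl ()))
  refine hBoth.congr fun w _ => ?_
  -- semantics
  have hsum : (∑ j : Fin n, (1 * if (if j ∈ candSet c then false
      else ((List.finRange t).map fun j' => (j, j')).all fun q => okLevelW c w q.2 (id q.1)) then 1 else 0)) =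
      #((univ : Finset (Fin n)).filter fun u => cntBitW c w u = true) := by
    rw [card_eq_sum_ones, sum_filter]
    refine sum_congr rfl fun u _ => ?_
    rw [one_mul]
    congr 1
    apply propext
    rw [cntBitW, decide_eq_true_eq]
    by_cases hu : u ∈ candSet c
    · simp [hu]
    · simp [hu, List.all_eq_true]
  apply Bool.eq_iff_iff.2
  simp only [Sum.elim_inr, Sum.elim_inl, Bool.and_eq_true, List.all_eq_true, List.mem_finRange, true_imp_iff,
    List.any_map, List.any_eq_true, Function.comp_apply, true_and, decide_eq_true_eq, verdictW, hsum]

/-! ### The trial and the detector -/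

/-- **One trial is a small circuit** computing `trialOut x c θ`. [folklore] -/
theorem cktSize_trialOut (c : Fin t → Fin M → Fin n) (θ : ℕ) :
    CktSize B2 (fun (x : EdgeVec n) (_ : Unit) => trialOut x c θ)
      ((0 + Fintype.card (Fin t × Fin M) * 1) +
        t * (0 + (Fintype.card ((Fin t × Fin M) × Fin t × Fin M) * 1 + Fintype.card ((Fin t × Fin M) × Fin t) * (M + 1) +
          Fintype.card (Fin t × Fin M) * (t + 1) + Fintype.card (Fin t × Fin M) * (M + 2))) +
        ((Fintype.card (Fin n × Fin t × Fin M) * 1 + Fintype.card (Fin n × Fin t) * (M + 1) +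
            Fintype.card (Fin n) * (t + 1) + 60 * (n + 3) ^ 4) +
          (Fintype.card (Fin t) * (M + 1) + (t + 1)) + 1)) :=
  (((cktSize_initW n t M).comp ((cktSize_layerW c).iterate t)).comp (cktSize_verdictW c θ)).congr fun x _ =>
    verdictW_iterate_eq_trialOut x c θ

/-- A crude polynomial bound for the size of one trial: `≤ 300 (n + t + M + 3)^6`. [folklore] -/
theorem trialSize_le (n t M : ℕ) :
    (0 + Fintype.card (Fin t × Fin M) * 1) +
        t * (0 + (Fintype.card ((Fin t × Fin M) × Fin t × Fin M) * 1 + Fintype.card ((Fin t × Fin M) × Fin t) * (M + 1) +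
          Fintype.card (Fin t × Fin M) * (t + 1) + Fintype.card (Fin t × Fin M) * (M + 2))) +
        ((Fintype.card (Fin n × Fin t × Fin M) * 1 + Fintype.card (Fin n × Fin t) * (M + 1) +
            Fintype.card (Fin n) * (t + 1) + 60 * (n + 3) ^ 4) +
          (Fintype.card (Fin t) * (M + 1) + (t + 1)) + 1) ≤ 300 * (n + t + M + 3) ^ 6 := by
  simp only [Fintype.card_prod, Fintype.card_fin]
  set X := n + t + M + 3 with hX
  have hn : n ≤ X := by omega
  have ht : t ≤ X := by omega
  have hM : M + 2 ≤ X := by omega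
  have h3 : n + 3 ≤ X := by omega
  have hX1 : 1 ≤ X := by omega
  have hM' : M ≤ X := by omega
  have hM1 : M + 1 ≤ X := by omega
  have ht1 : t + 1 ≤ X := by omega
  -- each summand is at most a small multiple of `X^6`
  have p2 : X ^ 2 = X * X := by ring
  have e1 : t * M ≤ X ^ 6 := by
    calc t * M ≤ X * X := Nat.mul_le_mul ht hM'
      _ = X ^ 2 := p2.symm
      _ ≤ X ^ 6 := Nat.pow_le_pow_right hX1 (by norm_num)
  have e2 : t * (t * M * (t * M)) ≤ X ^ 6 := by
    calc t * (t * M * (t * M)) ≤ X * (X * X * (X * X)) :=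
          Nat.mul_le_mul ht (Nat.mul_le_mul (Nat.mul_le_mul ht hM') (Nat.mul_le_mul ht hM'))
      _ = X ^ 5 := by ring
      _ ≤ X ^ 6 := Nat.pow_le_pow_right hX1 (by norm_num)
  have e3 : t * (t * M * t * (M + 1)) ≤ X ^ 6 := by
    calc t * (t * M * t * (M + 1)) ≤ X * (X * X * X * X) :=
          Nat.mul_le_mul ht (Nat.mul_le_mul (Nat.mul_le_mul (Nat.mul_le_mul ht hM') ht) hM1)
      _ = X ^ 5 := by ring
      _ ≤ X ^ 6 := Nat.pow_le_pow_right hX1 (by norm_num)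
  have e4 : t * (t * M * (t + 1)) ≤ X ^ 6 := by
    calc t * (t * M * (t + 1)) ≤ X * (X * X * X) :=
          Nat.mul_le_mul ht (Nat.mul_le_mul (Nat.mul_le_mul ht hM') ht1)
      _ = X ^ 4 := by ring
      _ ≤ X ^ 6 := Nat.pow_le_pow_right hX1 (by norm_num)
  have e5 : t * (t * M * (M + 2)) ≤ X ^ 6 := by
    calc t * (t * M * (M + 2)) ≤ X * (X * X * X) :=
          Nat.mul_le_mul ht (Nat.mul_le_mul (Nat.mul_le_mul ht hM') hM)
      _ = X ^ 4 := by ring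
      _ ≤ X ^ 6 := Nat.pow_le_pow_right hX1 (by norm_num)
  have e6 : n * (t * M) ≤ X ^ 6 := by
    calc n * (t * M) ≤ X * (X * X) := Nat.mul_le_mul hn (Nat.mul_le_mul ht hM')
      _ = X ^ 3 := by ring
      _ ≤ X ^ 6 := Nat.pow_le_pow_right hX1 (by norm_num)
  have e7 : n * t * (M + 1) ≤ X ^ 6 := by
    calc n * t * (M + 1) ≤ X * X * X := Nat.mul_le_mul (Nat.mul_le_mul hn ht) hM1
      _ = X ^ 3 := by ring
      _ ≤ X ^ 6 := Nat.pow_le_pow_right hX1 (by norm_num)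
  have e8 : n * (t + 1) ≤ X ^ 6 := by
    calc n * (t + 1) ≤ X * X := Nat.mul_le_mul hn ht1
      _ = X ^ 2 := p2.symm
      _ ≤ X ^ 6 := Nat.pow_le_pow_right hX1 (by norm_num)
  have e9 : 60 * (n + 3) ^ 4 ≤ 60 * X ^ 6 := by
    calc 60 * (n + 3) ^ 4 ≤ 60 * X ^ 4 := Nat.mul_le_mul_left _ (Nat.pow_le_pow_left h3 4)
      _ ≤ 60 * X ^ 6 := Nat.mul_le_mul_left _ (Nat.pow_le_pow_right hX1 (by norm_num))
  have e10 : t * (M + 1) ≤ X ^ 6 := by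
    calc t * (M + 1) ≤ X * X := Nat.mul_le_mul ht hM1
      _ = X ^ 2 := p2.symm
      _ ≤ X ^ 6 := Nat.pow_le_pow_right hX1 (by norm_num)
  have e11 : t + 1 + 1 ≤ X ^ 6 := by
    calc t + 1 + 1 ≤ X := by omega
      _ = X ^ 1 := (pow_one X).symm
      _ ≤ X ^ 6 := Nat.pow_le_pow_right hX1 (by norm_num)
  have hsplit : t * (0 + (t * M * (t * M) * 1 + t * M * t * (M + 1) + t * M * (t + 1) + t * M * (M + 2))) =
      t * (t * M * (t * M)) + t * (t * M * t * (M + 1)) + t * (t * M * (t + 1)) + t * (t * M * (M + 2)) := by ring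
  rw [hsplit]
  omega

/-- **The greedy detector is a fan-in-2 circuit.** For `R ≥ 1` trials with candidate tables `cs`, there is a
circuit over `B₂` of size at most `R · 300 (n+t+M+3)^6 + R + 1` computing `detOut x cs θ`. [folklore] -/
theorem exists_detOut_circuit {R : ℕ} (cs : Fin R → Fin t → Fin M → Fin n) (θ : ℕ) :
    ∃ C : Circuit ((⊤ : SimpleGraph (Fin n)).edgeSet), C.IsOver B2 ∧
      C.size ≤ R * (300 * (n + t + M + 3) ^ 6) + (R + 1) ∧ ∀ x, C.eval x = detOut x cs θ := by
  classical
  have hTrials : CktSize B2 (fun (x : EdgeVec n) (r : Fin R) => trialOut x (cs r) θ) (Fintype.card (Fin R) * (300 * (n + t + M + 3) ^ 6)) :=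
    CktSize.pi_const fun r => (cktSize_trialOut (cs r) θ).of_le (trialSize_le n t M)
  have hOr : CktSize B2 (fun (y : Fin R → Bool) (_ : Unit) => (List.finRange R).any fun r => y r) (R + 1) := by
    have h := cktSize_any_B2 (ι := Fin R) (List.finRange R)
    rwa [List.length_finRange] at h
  have h := hTrials.comp hOr
  rw [Fintype.card_fin] at h
  obtain ⟨C, hCB, hCs, hCe⟩ := h.toCircuit
  refine ⟨C, hCB, hCs, fun x => ?_⟩
  rw [hCe]
  apply Bool.eq_iff_iff.2
  simp [List.any_eq_true, detOut_eq_true_iff]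

end Summit.PneNP.PneNP.Theorems.MonotoneSuffices.Greedy

namespace Summit.PneNP.PneNP.Theorems.MonotoneSuffices.Greedy

/-- Registered sub-goal `greedy_circuit_main` of stmt-PneNP-18026 (greedy detector, part 9c): the detector is a
fan-in-2 circuit, exported verbatim. [folklore] -/
theorem greedy_circuit_main :
    ∀ {n t M R : ℕ} (cs : Fin R → Fin t → Fin M → Fin n) (θ : ℕ), ∃ C : Literature.Computability.Complexity.Circuit ((⊤ : SimpleGraph (Fin n)).edgeSet), C.IsOver Literature.Computability.Complexity.B2 ∧ C.size ≤ R * (300 * (n + t + M + 3) ^ 6) + (R + 1) ∧ ∀ x, C.eval x = Summit.PneNP.PneNP.Theorems.MonotoneSuffices.Greedy.detOut x cs θ :=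
  fun cs θ => exists_detOut_circuit cs θ

end Summit.PneNP.PneNP.Theorems.MonotoneSuffices.Greedy
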